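import Mathlib.MeasureTheory.Integral.Bochner.Set
import Mathlib.MeasureTheory.Function.ConditionalExpectation.Basic
import HarnessLib

/-!
# Elementary conditional averages of an event given a countably-valued random variable

(topic `Analysis/FunctionSpaces`, next to the Poisson point process files that consume it; one new
definition `condAvg`, no named facts, Mathlib only.)

Let `μ` be a finite measure on `Ω`, `X : Ω → S` a map into a countable set `S` with measurable
points (a *discrete observation*: the vector of counts of a point configuration in the cells of a
finite partition, the first `n` coordinates of a sequence, …) and `A ⊆ Ω` an event. The
**elementary conditional average** of `A` given `X` is the function
`condAvg μ X A : Ω → ℝ`, `ω ↦ μ(A ∩ {X = X ω}) / μ{X = X ω}`, i.e. the conditional probability of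
`A` given the atom of `ω` in the countable partition `{X = s}, s ∈ S` ("the elementary case" of
conditioning: Williams, *Probability with Martingales* (1991), §9.1; Durrett, *Probability: Theory
and Examples*, §4.1, Example "finite or countable partition"; Kallenberg, *Foundations* (2021),
Ch. 8). It is a genuine function, constant on the fibres of `X`, defined at EVERY point (value `0`
on the atoms of mass zero, which altogether form a null set, `measure_setOf_fiber_null`), so that
the basic calculus below holds pointwise and no almost-everywhere bookkeeping is needed; it is a
version of Mathlib's conditional expectation `μ[𝟙_A | σ(X)]` (`condAvg_ae_eq_condExp`).

## Main results (all proved)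

* `condAvg_eq_comp`, `measurable_condAvg`, `condAvg_nonneg`, `condAvg_le_one`, `condAvg_mono`,
  `integrable_condAvg` — `condAvg μ X A = g ∘ X` is measurable, `[0,1]`-valued, monotone in `A`.
* TOWER: `setIntegral_condAvg_fiber` (`∫_{X = s} condAvg = μ(A ∩ {X = s})` for every `s`),
  `setIntegral_condAvg_preimage` (`∫_{X ∈ T} condAvg = μ(A ∩ {X ∈ T})` for every `T ⊆ S`),
  `integral_condAvg` (`∫ condAvg = μ A`).
* IDEMPOTENCE on `σ(X)`-events: `condAvg_preimage_apply` (`condAvg μ X {X ∈ T} = 𝟙_{X ∈ T}` at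
  every point whose atom has positive mass) and `condAvg_preimage_ae_eq` (hence a.e.).
* CONTRACTION: `abs_condAvg_sub_condAvg_le` (`|condAvg A − condAvg B| ≤ condAvg (A ∆ B)`
  pointwise) and `integral_abs_condAvg_sub_condAvg_le` (`∫ |condAvg A − condAvg B| ≤ μ(A ∆ B)`).
* APPROXIMATION: `integral_abs_condAvg_sub_indicator_le` —
  `∫ |condAvg μ X A − 𝟙_A| ≤ 2 μ(A ∆ {X ∈ T})` for every `T ⊆ S`: if `A` is well approximated by
  an event of `σ(X)`, then `condAvg μ X A` is `L¹`-close to `𝟙_A` (the quantitative form of Lévy's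
  upward theorem `μ[𝟙_A | 𝓕ₙ] → 𝟙_A` along a filtration generated by finer and finer discrete
  observations, Williams 1991, Thm. 14.2, used with Mathlib's `MeasureTheory.MeasureDense`).
* PRODUCT CONVERGENCE: `abs_integral_condAvg_mul_condAvg_sub_le` —
  `|∫ condAvg A · condAvg B − μ(A ∩ B)| ≤ 2 μ(A ∆ {X ∈ T}) + 2 μ(B ∆ {X ∈ T'})`, the estimate that
  transfers a correlation inequality for functions of `X` (e.g. Harris–FKG for the counts of a
  Poisson process in finitely many cells) to the events `A, B` themselves.
* `condAvg_ae_eq_condExp` — `condAvg μ X A = μ[𝟙_A | σ(X)]` almost everywhere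
  (`σ(X) = MeasurableSpace.comap X`).

## Design

Real division by zero is zero, so null atoms need no case distinction in the definition; every
statement in which this junk value could matter is either an inequality that holds trivially
there (`condAvg_le_one`, the contraction) or carries the hypothesis `μ{X = X ω} ≠ 0` / holds a.e.
Finiteness of `μ` is assumed from the tower property on (no `IsProbabilityMeasure` needed);
measurability of `A` only where `𝟙_A` is integrated or a countable additivity in `A ∩ {X = s}` is
used. Nothing here is specific to point processes.

## References

* D. Williams, *Probability with Martingales*, CUP (1991), §9.1, §9.7, Thm. 14.2.
* R. Durrett, *Probability: Theory and Examples*, 5th ed., CUP (2019), §4.1.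
* O. Kallenberg, *Foundations of Modern Probability*, 3rd ed., Springer (2021), Ch. 8.
-/

noncomputable section

open MeasureTheory Set Filter
open scoped ENNReal symmDiff

namespace Literature.Analysis.FunctionSpaces

variable {Ω : Type*} [MeasurableSpace Ω] {S : Type*}

/-- The **elementary conditional average** of the event `A` given the (countably-valued) random
variable `X`: on the atom `{X = s}` it is `μ(A ∩ {X = s}) / μ{X = s}`, and `0` on atoms of mass
zero (real division by zero). A pointwise-defined version of `μ[𝟙_A | σ(X)]`
(`condAvg_ae_eq_condExp`); Williams (1991), §9.1. [folklore] -/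
def condAvg (μ : Measure Ω) (X : Ω → S) (A : Set Ω) (ω : Ω) : ℝ :=
  μ.real (A ∩ X ⁻¹' {X ω}) / μ.real (X ⁻¹' {X ω})

section Pointwise

variable (μ : Measure Ω) (X : Ω → S) (A : Set Ω)

/-- Unfolding `condAvg` at a point. [folklore] -/
theorem condAvg_apply (ω : Ω) :
    condAvg μ X A ω = μ.real (A ∩ X ⁻¹' {X ω}) / μ.real (X ⁻¹' {X ω}) := rfl

/-- `condAvg μ X A` factors through `X`: it is the function
`s ↦ μ(A ∩ {X = s}) / μ{X = s}` on `S` composed with `X`. [folklore] -/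
theorem condAvg_eq_comp :
    condAvg μ X A = (fun s => μ.real (A ∩ X ⁻¹' {s}) / μ.real (X ⁻¹' {s})) ∘ X := rfl

/-- `condAvg μ X A` is constant on the fibres of `X`. [folklore] -/
theorem condAvg_eq_of_apply_eq {ω ω' : Ω} (h : X ω = X ω') :
    condAvg μ X A ω = condAvg μ X A ω' := by
  simp only [condAvg, h]

/-- `0 ≤ condAvg μ X A ω`. [folklore] -/
theorem condAvg_nonneg (ω : Ω) : 0 ≤ condAvg μ X A ω :=
  div_nonneg measureReal_nonneg measureReal_nonneg

/-- `condAvg μ X A ω ≤ 1` (for every measure: an atom of infinite mass has real mass `0` and the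
quotient is the junk value `0`). [folklore] -/
theorem condAvg_le_one (ω : Ω) : condAvg μ X A ω ≤ 1 := by
  unfold condAvg
  by_cases htop : μ (X ⁻¹' {X ω}) = ∞
  · simp [measureReal_def, htop]
  · exact div_le_one_of_le₀ (measureReal_mono inter_subset_right htop) measureReal_nonneg

/-- `|condAvg μ X A ω| ≤ 1`. [folklore] -/
theorem abs_condAvg_le_one (ω : Ω) : |condAvg μ X A ω| ≤ 1 := by
  rw [abs_of_nonneg (condAvg_nonneg μ X A ω)]
  exact condAvg_le_one μ X A ω

/-- The conditional average of the empty event vanishes. [folklore] -/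
@[simp] theorem condAvg_empty : condAvg μ X ∅ = 0 := by
  funext ω
  simp [condAvg]

/-- Monotonicity in the event: `A ⊆ B → condAvg μ X A ≤ condAvg μ X B` (finite measure).
[folklore] -/
theorem condAvg_mono [IsFiniteMeasure μ] {A B : Set Ω} (h : A ⊆ B) (ω : Ω) :
    condAvg μ X A ω ≤ condAvg μ X B ω :=
  div_le_div_of_nonneg_right (measureReal_mono (inter_subset_inter_left _ h)) measureReal_nonneg

/-- The atoms `{X = X ω}` of mass zero altogether form a null set (`S` countable: it is a countable
union of null fibres). [folklore] -/
theorem measure_setOf_fiber_null [Countable S] : μ {ω | μ (X ⁻¹' {X ω}) = 0} = 0 := by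
  have hsub : {ω | μ (X ⁻¹' {X ω}) = 0} ⊆ ⋃ s : {s : S // μ (X ⁻¹' {s}) = 0}, X ⁻¹' {(s : S)} :=
    fun ω hω => mem_iUnion.2 ⟨⟨X ω, hω⟩, rfl⟩
  exact measure_mono_null hsub (measure_iUnion_null_iff.2 fun s => s.2)

/-- Almost every point lies in an atom `{X = X ω}` of positive mass (`S` countable). [folklore] -/
theorem ae_measure_fiber_ne_zero [Countable S] : ∀ᵐ ω ∂μ, μ (X ⁻¹' {X ω}) ≠ 0 := by
  simp only [ae_iff, not_not]
  exact measure_setOf_fiber_null μ X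

end Pointwise

section Idempotence

variable (μ : Measure Ω) (X : Ω → S)

/-- On a `σ(X)`-event `{X ∈ T}` containing `ω`, `condAvg μ X {X ∈ T} ω = 1` provided the atom of
`ω` has nonzero (real) mass. [folklore] -/
theorem condAvg_preimage_apply_of_mem {T : Set S} {ω : Ω} (hω : X ω ∈ T)
    (h0 : μ.real (X ⁻¹' {X ω}) ≠ 0) : condAvg μ X (X ⁻¹' T) ω = 1 := by
  have : X ⁻¹' T ∩ X ⁻¹' {X ω} = X ⁻¹' {X ω} :=
    inter_eq_right.2 (preimage_mono (singleton_subset_iff.2 hω))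
  rw [condAvg, this, div_self h0]

/-- Off the `σ(X)`-event `{X ∈ T}`, `condAvg μ X {X ∈ T} ω = 0`. [folklore] -/
theorem condAvg_preimage_apply_of_notMem {T : Set S} {ω : Ω} (hω : X ω ∉ T) :
    condAvg μ X (X ⁻¹' T) ω = 0 := by
  rw [condAvg, ← preimage_inter, inter_singleton_eq_empty.2 hω, preimage_empty,
    measureReal_empty, zero_div]

/-- **Idempotence on `σ(X)`-events, pointwise**: `condAvg μ X {X ∈ T} ω = 𝟙_{X ∈ T}(ω)` at every
point whose atom has nonzero (real) mass. [folklore] -/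
theorem condAvg_preimage_apply {T : Set S} {ω : Ω} (h0 : μ.real (X ⁻¹' {X ω}) ≠ 0) :
    condAvg μ X (X ⁻¹' T) ω = (X ⁻¹' T).indicator 1 ω := by
  by_cases hω : X ω ∈ T
  · rw [condAvg_preimage_apply_of_mem μ X hω h0, indicator_of_mem (mem_preimage.2 hω),
      Pi.one_apply]
  · rw [condAvg_preimage_apply_of_notMem μ X hω, indicator_of_notMem (by exact hω)]

/-- **Idempotence on `σ(X)`-events, a.e.**: `condAvg μ X {X ∈ T} = 𝟙_{X ∈ T}` almost everywhere
(finite measure, `S` countable). [folklore] -/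
theorem condAvg_preimage_ae_eq [IsFiniteMeasure μ] [Countable S] (T : Set S) :
    condAvg μ X (X ⁻¹' T) =ᵐ[μ] (X ⁻¹' T).indicator 1 := by
  filter_upwards [ae_measure_fiber_ne_zero μ X] with ω hω
  exact condAvg_preimage_apply μ X (by rwa [Ne, measureReal_eq_zero_iff])

end Idempotence

section Contraction

variable (μ : Measure Ω) [IsFiniteMeasure μ] (X : Ω → S)

/-- `|μ s − μ t| ≤ μ(s ∆ t)` for a finite measure and ARBITRARY sets `s, t` (Mathlib's
`abs_measureReal_sub_le_measureReal_symmDiff` asks null-measurability; only monotonicity and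
subadditivity of the outer measure are used here). [folklore] -/
theorem abs_measureReal_sub_le_symmDiff (s t : Set Ω) :
    |μ.real s - μ.real t| ≤ μ.real (s ∆ t) := by
  have key : ∀ s t : Set Ω, μ.real s ≤ μ.real t + μ.real (s ∆ t) := fun s t =>
    calc μ.real s ≤ μ.real (t ∪ s ∆ t) :=
          measureReal_mono fun x hx => by rw [mem_union, mem_symmDiff]; tauto
      _ ≤ μ.real t + μ.real (s ∆ t) := measureReal_union_le _ _
  have h1 := key s t
  have h2 := key t s
  rw [symmDiff_comm] at h2
  rw [abs_sub_le_iff]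
  constructor <;> linarith

/-- **Contraction, pointwise**: `|condAvg μ X A ω − condAvg μ X B ω| ≤ condAvg μ X (A ∆ B) ω` for
arbitrary events `A, B` (on the atom `F` of `ω`:
`|μ(A ∩ F) − μ(B ∩ F)| ≤ μ((A ∆ B) ∩ F)`). [folklore] -/
theorem abs_condAvg_sub_condAvg_le (A B : Set Ω) (ω : Ω) :
    |condAvg μ X A ω - condAvg μ X B ω| ≤ condAvg μ X (A ∆ B) ω := by
  simp only [condAvg]
  rw [← sub_div, abs_div, abs_of_nonneg (measureReal_nonneg (s := X ⁻¹' {X ω}))]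
  refine div_le_div_of_nonneg_right ?_ measureReal_nonneg
  rw [inter_symmDiff_distrib_right]
  exact abs_measureReal_sub_le_symmDiff μ _ _

omit [MeasurableSpace Ω] in
/-- `|𝟙_s(ω) − 𝟙_t(ω)| = 𝟙_{s ∆ t}(ω)`. [folklore] -/
theorem abs_indicator_one_sub_indicator_one (s t : Set Ω) (ω : Ω) :
    |s.indicator (1 : Ω → ℝ) ω - t.indicator 1 ω| = (s ∆ t).indicator 1 ω := by
  by_cases hs : ω ∈ s <;> by_cases ht : ω ∈ t <;> simp [mem_symmDiff, hs, ht]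

end Contraction

section Tower

variable {μ : Measure Ω} [IsFiniteMeasure μ] [MeasurableSpace S] [MeasurableSingletonClass S]
  {X : Ω → S}

omit [IsFiniteMeasure μ] in
/-- `condAvg μ X A` is measurable (`X` measurable, `S` countable with measurable points).
[folklore] -/
@[fun_prop]
theorem measurable_condAvg [Countable S] (hX : Measurable X) (A : Set Ω) :
    Measurable (condAvg μ X A) := by
  rw [condAvg_eq_comp]
  exact (measurable_of_countable _).comp hX

/-- `condAvg μ X A` is integrable (bounded by `1`, finite measure). [folklore] -/
theorem integrable_condAvg [Countable S] (hX : Measurable X) (A : Set Ω) :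
    Integrable (condAvg μ X A) μ :=
  Integrable.of_bound (measurable_condAvg hX A).aestronglyMeasurable 1
    (ae_of_all _ fun ω => by rw [Real.norm_eq_abs]; exact abs_condAvg_le_one μ X A ω)

/-- **Tower property on atoms**: `∫_{X = s} condAvg μ X A dμ = μ(A ∩ {X = s})` for EVERY `s`
(the integrand is the constant `μ(A ∩ {X = s}) / μ{X = s}` on the atom; on a null atom both sides
vanish). [folklore] -/
theorem setIntegral_condAvg_fiber (hX : Measurable X) (A : Set Ω) (s : S) :
    ∫ ω in X ⁻¹' {s}, condAvg μ X A ω ∂μ = μ.real (A ∩ X ⁻¹' {s}) := by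
  have h : EqOn (condAvg μ X A) (fun _ => μ.real (A ∩ X ⁻¹' {s}) / μ.real (X ⁻¹' {s}))
      (X ⁻¹' {s}) := by
    intro ω hω
    rw [mem_preimage, mem_singleton_iff] at hω
    simp only [condAvg, hω]
  rw [setIntegral_congr_fun (hX (measurableSet_singleton s)) h, setIntegral_const, smul_eq_mul]
  by_cases h0 : μ.real (X ⁻¹' {s}) = 0
  · rw [h0, zero_mul]
    exact (measureReal_mono_null inter_subset_right h0).symm
  · rw [← mul_div_assoc, mul_div_cancel_left₀ _ h0]

/-- **Tower property on `σ(X)`-events**: `∫_{X ∈ T} condAvg μ X A dμ = μ(A ∩ {X ∈ T})` for every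
`T ⊆ S` (`S` countable, `A` measurable; sum the atom identities over the countable partition
`{X = s}, s ∈ T`). [folklore] -/
theorem setIntegral_condAvg_preimage [Countable S] (hX : Measurable X) {A : Set Ω}
    (hA : MeasurableSet A) (T : Set S) :
    ∫ ω in X ⁻¹' T, condAvg μ X A ω ∂μ = μ.real (A ∩ X ⁻¹' T) := by
  have hm : ∀ s : T, MeasurableSet (X ⁻¹' {(s : S)}) := fun s => hX (measurableSet_singleton _)
  have hd : Pairwise (Function.onFun Disjoint fun s : T => X ⁻¹' {(s : S)}) := fun i j hij =>
    (disjoint_singleton.2 (Subtype.val_injective.ne hij)).preimage X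
  have hU : X ⁻¹' T = ⋃ s : T, X ⁻¹' {(s : S)} := by
    ext ω
    simp
  rw [hU, integral_iUnion hm hd (integrable_condAvg hX A).integrableOn, inter_iUnion,
    measureReal_def,
    measure_iUnion (fun i j hij => (hd hij).mono inter_subset_right inter_subset_right)
      fun s => hA.inter (hm s),
    ENNReal.tsum_toReal_eq fun _ => measure_ne_top _ _]
  exact tsum_congr fun s => setIntegral_condAvg_fiber hX A s

/-- **Tower property, total mass**: `∫ condAvg μ X A dμ = μ A`. [folklore] -/
theorem integral_condAvg [Countable S] (hX : Measurable X) {A : Set Ω} (hA : MeasurableSet A) :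
    ∫ ω, condAvg μ X A ω ∂μ = μ.real A := by
  have h := setIntegral_condAvg_preimage (μ := μ) hX hA (univ : Set S)
  rwa [preimage_univ, Measure.restrict_univ, inter_univ] at h

/-- **Contraction in `L¹`**: `∫ |condAvg μ X A − condAvg μ X B| dμ ≤ μ(A ∆ B)`. [folklore] -/
theorem integral_abs_condAvg_sub_condAvg_le [Countable S] (hX : Measurable X) {A B : Set Ω}
    (hA : MeasurableSet A) (hB : MeasurableSet B) :
    ∫ ω, |condAvg μ X A ω - condAvg μ X B ω| ∂μ ≤ μ.real (A ∆ B) := by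
  calc ∫ ω, |condAvg μ X A ω - condAvg μ X B ω| ∂μ ≤ ∫ ω, condAvg μ X (A ∆ B) ω ∂μ :=
        integral_mono_of_nonneg (ae_of_all _ fun _ => abs_nonneg _) (integrable_condAvg hX _)
          (ae_of_all _ fun ω => abs_condAvg_sub_condAvg_le μ X A B ω)
    _ = μ.real (A ∆ B) := integral_condAvg hX (hA.symmDiff hB)

/-- **Approximation (the key estimate)**: for a measurable event `A` and every `T ⊆ S`,
`∫ |condAvg μ X A − 𝟙_A| dμ ≤ 2 μ(A ∆ {X ∈ T})`: triangle inequality through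
`condAvg μ X {X ∈ T} = 𝟙_{X ∈ T}` (a.e.), the contraction, and
`∫ |𝟙_{X ∈ T} − 𝟙_A| = μ(A ∆ {X ∈ T})`.
So `condAvg μ X A` is `L¹`-close to `𝟙_A` as soon as `A` is close to some event of `σ(X)`.
[folklore] -/
theorem integral_abs_condAvg_sub_indicator_le [Countable S] (hX : Measurable X) {A : Set Ω}
    (hA : MeasurableSet A) (T : Set S) :
    ∫ ω, |condAvg μ X A ω - A.indicator 1 ω| ∂μ ≤ 2 * μ.real (A ∆ (X ⁻¹' T)) := by
  set E : Set Ω := X ⁻¹' T with hE_def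
  have hE : MeasurableSet E := hX (Set.to_countable T).measurableSet
  have hAE : MeasurableSet (A ∆ E) := hA.symmDiff hE
  have key : ∀ᵐ ω ∂μ, |condAvg μ X A ω - A.indicator 1 ω| ≤
      condAvg μ X (A ∆ E) ω + (A ∆ E).indicator 1 ω := by
    have hae : condAvg μ X E =ᵐ[μ] E.indicator 1 := condAvg_preimage_ae_eq μ X T
    filter_upwards [hae] with ω hω
    calc |condAvg μ X A ω - A.indicator 1 ω|
        = |(condAvg μ X A ω - condAvg μ X E ω) + (E.indicator 1 ω - A.indicator 1 ω)| := by
          rw [hω]; congr 1; ring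
      _ ≤ |condAvg μ X A ω - condAvg μ X E ω| + |E.indicator 1 ω - A.indicator 1 ω| :=
          abs_add_le _ _
      _ ≤ condAvg μ X (A ∆ E) ω + (A ∆ E).indicator 1 ω := by
          refine add_le_add (abs_condAvg_sub_condAvg_le μ X A E ω) (le_of_eq ?_)
          rw [abs_indicator_one_sub_indicator_one, symmDiff_comm]
  have h1 : Integrable ((A ∆ E).indicator (1 : Ω → ℝ)) μ :=
    (integrable_const (1 : ℝ)).indicator hAE
  have hint : Integrable (fun ω => condAvg μ X (A ∆ E) ω + (A ∆ E).indicator 1 ω) μ :=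
    (integrable_condAvg hX _).add h1
  calc ∫ ω, |condAvg μ X A ω - A.indicator 1 ω| ∂μ
      ≤ ∫ ω, (condAvg μ X (A ∆ E) ω + (A ∆ E).indicator 1 ω) ∂μ :=
        integral_mono_of_nonneg (ae_of_all _ fun _ => abs_nonneg _) hint key
    _ = μ.real (A ∆ E) + μ.real (A ∆ E) := by
        rw [integral_add (integrable_condAvg hX _) h1, integral_condAvg hX hAE,
          integral_indicator_one hAE]
    _ = 2 * μ.real (A ∆ E) := by ring

omit [IsFiniteMeasure μ] in
/-- `∫ 𝟙_A 𝟙_B dμ = μ(A ∩ B)`. [folklore] -/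
theorem integral_indicator_one_mul_indicator_one {A B : Set Ω} (hA : MeasurableSet A)
    (hB : MeasurableSet B) :
    ∫ ω, A.indicator (1 : Ω → ℝ) ω * B.indicator 1 ω ∂μ = μ.real (A ∩ B) := by
  rw [← integral_indicator_one (hA.inter hB), inter_indicator_one]
  rfl

/-- **Product convergence**: for measurable events `A, B` and every `T, T' ⊆ S`,
`|∫ condAvg μ X A · condAvg μ X B dμ − μ(A ∩ B)| ≤ 2 μ(A ∆ {X ∈ T}) + 2 μ(B ∆ {X ∈ T'})`
(write `f g − 𝟙_A 𝟙_B = (f − 𝟙_A) g + 𝟙_A (g − 𝟙_B)` with `|g|, |𝟙_A| ≤ 1` and use the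
approximation estimate twice). This is the step that transfers a correlation inequality between
functions of the discrete observation `X` to the events themselves. [folklore] -/
theorem abs_integral_condAvg_mul_condAvg_sub_le [Countable S] (hX : Measurable X) {A B : Set Ω}
    (hA : MeasurableSet A) (hB : MeasurableSet B) (T T' : Set S) :
    |∫ ω, condAvg μ X A ω * condAvg μ X B ω ∂μ - μ.real (A ∩ B)| ≤
      2 * μ.real (A ∆ (X ⁻¹' T)) + 2 * μ.real (B ∆ (X ⁻¹' T')) := by
  set f := condAvg μ X A
  set g := condAvg μ X B
  set a : Ω → ℝ := A.indicator 1 with ha_def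
  set b : Ω → ℝ := B.indicator 1
  have hf : Integrable f μ := integrable_condAvg hX A
  have hg : Integrable g μ := integrable_condAvg hX B
  have ha : Integrable a μ := (integrable_const (1 : ℝ)).indicator hA
  have hb : Integrable b μ := (integrable_const (1 : ℝ)).indicator hB
  have hg1 : ∀ ω, |g ω| ≤ 1 := abs_condAvg_le_one μ X B
  have ha1 : ∀ ω, |a ω| ≤ 1 := fun ω => by
    by_cases h : ω ∈ A <;> simp [ha_def, h]
  have hfg : Integrable (fun ω => f ω * g ω) μ := hg.bdd_mul hf.aestronglyMeasurable
    (ae_of_all _ fun ω => by rw [Real.norm_eq_abs]; exact abs_condAvg_le_one μ X A ω)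
  have hab : Integrable (fun ω => a ω * b ω) μ := hb.bdd_mul ha.aestronglyMeasurable
    (ae_of_all _ fun ω => by rw [Real.norm_eq_abs]; exact ha1 ω)
  have hpt : ∀ ω, |f ω * g ω - a ω * b ω| ≤ |f ω - a ω| + |g ω - b ω| := fun ω =>
    calc |f ω * g ω - a ω * b ω| = |(f ω - a ω) * g ω + a ω * (g ω - b ω)| := by ring_nf
      _ ≤ |(f ω - a ω) * g ω| + |a ω * (g ω - b ω)| := abs_add_le _ _
      _ = |f ω - a ω| * |g ω| + |a ω| * |g ω - b ω| := by rw [abs_mul, abs_mul]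
      _ ≤ |f ω - a ω| * 1 + 1 * |g ω - b ω| := by
          gcongr
          · exact hg1 ω
          · exact ha1 ω
      _ = |f ω - a ω| + |g ω - b ω| := by ring
  have hint : Integrable (fun ω => |f ω - a ω| + |g ω - b ω|) μ :=
    (hf.sub ha).abs.add (hg.sub hb).abs
  calc |∫ ω, f ω * g ω ∂μ - μ.real (A ∩ B)|
      = |∫ ω, (f ω * g ω - a ω * b ω) ∂μ| := by
        rw [integral_sub hfg hab, integral_indicator_one_mul_indicator_one hA hB]
    _ ≤ ∫ ω, |f ω * g ω - a ω * b ω| ∂μ := abs_integral_le_integral_abs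
    _ ≤ ∫ ω, (|f ω - a ω| + |g ω - b ω|) ∂μ :=
        integral_mono_of_nonneg (ae_of_all _ fun _ => abs_nonneg _) hint (ae_of_all _ hpt)
    _ = ∫ ω, |f ω - a ω| ∂μ + ∫ ω, |g ω - b ω| ∂μ := integral_add (hf.sub ha).abs (hg.sub hb).abs
    _ ≤ 2 * μ.real (A ∆ (X ⁻¹' T)) + 2 * μ.real (B ∆ (X ⁻¹' T')) :=
        add_le_add (integral_abs_condAvg_sub_indicator_le hX hA T)
          (integral_abs_condAvg_sub_indicator_le hX hB T')

/-- **`condAvg` is a version of the conditional expectation**: for measurable `A`,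
`condAvg μ X A = μ[𝟙_A | σ(X)]` almost everywhere, where `σ(X) = MeasurableSpace.comap X _`
(both are `σ(X)`-measurable with the same integrals on the events `{X ∈ T}`; Williams 1991, §9.1).
[folklore] -/
theorem condAvg_ae_eq_condExp [Countable S] (hX : Measurable X) {A : Set Ω}
    (hA : MeasurableSet A) :
    condAvg μ X A =ᵐ[μ]
      μ[A.indicator (1 : Ω → ℝ) | MeasurableSpace.comap X ‹MeasurableSpace S›] := by
  have hm : MeasurableSpace.comap X ‹MeasurableSpace S› ≤ ‹MeasurableSpace Ω› := hX.comap_le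
  refine ae_eq_condExp_of_forall_setIntegral_eq hm ((integrable_const (1 : ℝ)).indicator hA)
    (fun s _ _ => (integrable_condAvg hX A).integrableOn) ?_ ?_
  · rintro _ ⟨T, -, rfl⟩ -
    rw [setIntegral_condAvg_preimage hX hA T, setIntegral_indicator hA, inter_comm]
    simp only [Pi.one_apply, setIntegral_const, smul_eq_mul, mul_one]
  · have hg : Measurable[MeasurableSpace.comap X ‹MeasurableSpace S›] (condAvg μ X A) := by
      rw [condAvg_eq_comp]
      exact (measurable_of_countable _).comp (comap_measurable X)
    exact hg.stronglyMeasurable.aestronglyMeasurable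

end Tower

end Literature.Analysis.FunctionSpaces
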